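/-
Copyright (c) 2026. All rights reserved.
Released under Apache 2.0 license as described in the file LICENSE.
Authors: abc-iut cell, seat abc-iut-L4-t14 (gen 5; proof-only, row «HFIN-FREE»: the PRINT-FAITHFUL (RC) geometric
column of [AbsTopIII] Prop 4.2 (i) / Cor 4.5 at the uniformised model WITHOUT the finite-fibre binder `hfin`).
-/
import Literature.AnabelianGeometry.AbsoluteAnabelian.ArchimedeanHolFieldFunctorGeometricPSLHfinFree
import HarnessLib

/-!
# [AbsTopIII] Prop 4.2 (i) in the RC-category at the uniformised model WITHOUT `hfin`

S. Mochizuki, *Topics in absolute anabelian geometry III*, proof of Prop 4.2 (i) p. 106 l. 14–19 (kurims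
`paper:url-5493eb38cbb7`; bib key `MochizukiAbsTopIII2015`).  The morphisms of `EA` are the PRINT-FAITHFUL
ones — RC-holomorphic finite étale maps (Def 4.1 (iii), Cor 2.3 (i); the tree's category `HolRS.RC`).

PROOF-ONLY twin of `ArchimedeanHolFieldFunctorGeometricPSLHfinFree.lean` (no definition, no named fact): the
RC column of abc-iut-L4-t14's gen-4/5 files (`RC.app_self_eq_id_of_isFreeOrSurface`, p463688, …) carried
the analytic binder `hfin` only because the naturality morphisms were taken from the functor
`pslLocFunctor Γ̄ hfin` on ALL of `Loc(PSL₂(ℝ), Γ̄)`.  The argument uses naturality only along the structure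
inclusions `[1]` and the deck transformations `[γ]`, `γ ∈ Γ̄`, which are FINITE étale by index arithmetic
(`LocObj.finiteIndex_conjSubgroup_subgroupOf_of_mem`).  Hence:

* ★ `HolRS.RC.app_self_eq_id_of_isFreeOrSurface_hfinFree` — (H1⁎) in the RC-category, `Γ̄` free-or-surface,
  non-abelian, `[N_{PGL₂(ℝ)}(Γ̄) : Γ̄] < ∞`, NO `hfin`;
* ★★ `HolRS.RC.isIdRigid_mapsTo_pslQuotient_of_isFreeOrSurface_hfinFree`,
  `HolRS.RC.isIdRigid_EA_mapsTo_pslQuotient_of_isFreeOrSurface_hfinFree` (+ Cor 4.5) — the RC column with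
  residual hypothesis `hN` (PSL currency) ONLY;
* ★★ `HolRS.RC.…_of_cusps_hfinFree` — PUNCTURED case, residual = (P)+(FC) ONLY (no arithmeticity, no
  finite area), print-faithful morphisms.

HONEST SCOPE: MODEL side of [AbsTopIII] §4 (model ≠ reconstruction); `IsFreeOrSurface Γ̄` structural; orbi
objects and `EA` beyond one `X₀` untouched.  Classical; nothing here bears on [IUTchIII] Cor. 3.12.
-/

set_option autoImplicit false

noncomputable section

open scoped Manifold ContDiff Topology UpperHalfPlane MatrixGroups Matrix
open _root_.MulAction _root_.CategoryTheory
open Literature.AlgebraicGeometry.Frobenioids (IsSlimGroup)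
open Literature.IUT.HodgeTheaters (profiniteCompletion IsFreeOrSurface)
open Matrix.ProjectiveSpecialLinearGroup (toPGL toPGL_mk toPGL_injective)
open Literature.Geometry.Manifold.QuotientManifold (conjSubgroup)

namespace Literature.AnabelianGeometry.AbsoluteAnabelian

namespace HolRS

variable (Γ : Subgroup PSL2R) [ProperlyDiscontinuousSMul Γ ℍ] [IsCancelSMul Γ ℍ]

/-! ### (H1⁎) in the RC-category without `hfin` -/

/-- ★ **(H1⁎) for print's RC-morphisms, `Γ̄` free-or-surface, WITHOUT `hfin`**: `Γ̄ ≤ PSL₂(ℝ)` free of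
finite rank or an orientable surface group, non-abelian, acting freely and properly discontinuously on `ℍ`,
`[N_{PGL₂(ℝ)}(Γ̄) : Γ̄] < ∞` ⇒ every automorphism `α` of the identity functor of «objects of `RC` mapping
to `⟨ℍ/Γ̄⟩`» has `α_{ℍ/Γ̄} = 𝟙` (abc-iut-L4-t14's p463688 argument with the naturality morphisms taken
directly as `toRC.map (pslQuotientHom …)` along structure inclusions and decks — finite index by group
theory). [cite: MochizukiAbsTopIII2015, Proposition 4.2 (i) proof p.106] -/
theorem RC.app_self_eq_id_of_isFreeOrSurface_hfinFree (hΓ : IsFreeOrSurface Γ)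
    (hab : ∃ a b : Γ, a * b ≠ b * a)
    [hN' : ((Γ.map (toPGL (n := Fin 2) (R := ℝ))).subgroupOf
      (Subgroup.normalizer ((Γ.map (toPGL (n := Fin 2) (R := ℝ)) : Subgroup PGL(2, ℝ)) :
        Set PGL(2, ℝ)))).FiniteIndex]
    (α : 𝟭 (ObjectProperty.FullSubcategory fun Y : RC =>
      Nonempty (Y ⟶ HolRS.toRC.obj (HolRS.pslQuotient Γ))) ≅ 𝟭 _) :
    (α.hom.app (mapsToSelf (HolRS.toRC.obj (HolRS.pslQuotient Γ)))).hom =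
      𝟙 (HolRS.toRC.obj (HolRS.pslQuotient Γ)) := by
  classical
  let Γ' : Subgroup PGL(2, ℝ) := Γ.map (toPGL (n := Fin 2) (R := ℝ))
  let C := ObjectProperty.FullSubcategory fun Y : RC => Nonempty (Y ⟶ toRC.obj (pslQuotient Γ))
  -- instances at the objects `Λ̄`
  have iPD : ∀ Λ : _root_.Literature.AnabelianGeometry.AbsoluteAnabelian.LocObj Γ,
      ProperlyDiscontinuousSMul Λ.toSubgroup ℍ := fun Λ =>
    Subgroup.properlyDiscontinuousSMul_of_le ‹ProperlyDiscontinuousSMul Γ ℍ› Λ.le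
  have iC : ∀ Λ : _root_.Literature.AnabelianGeometry.AbsoluteAnabelian.LocObj Γ,
      IsCancelSMul Λ.toSubgroup ℍ := fun Λ => isCancelSMul_of_le upperHalfPlane Γ Λ.le
  have hle1 : ∀ Λ : _root_.Literature.AnabelianGeometry.AbsoluteAnabelian.LocObj Γ,
      ∀ x ∈ Λ.toSubgroup, (1 : PSL2R) * x * 1⁻¹ ∈ (LocObj.top Γ).toSubgroup := fun Λ x hx => by
    simpa using Λ.le hx
  have iF1 : ∀ Λ : _root_.Literature.AnabelianGeometry.AbsoluteAnabelian.LocObj Γ,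
      ((conjSubgroup (1 : PSL2R) Λ.toSubgroup).subgroupOf (LocObj.top Γ).toSubgroup).FiniteIndex :=
    fun Λ => LocObj.finiteIndex_conjSubgroup_subgroupOf_of_mem Λ (LocObj.top Γ) Γ.one_mem (hle1 Λ)
  let s : ∀ Λ : _root_.Literature.AnabelianGeometry.AbsoluteAnabelian.LocObj Γ,
      pslQuotient Λ.toSubgroup ⟶ pslQuotient Γ := fun Λ =>
    haveI := iPD Λ; haveI := iC Λ; haveI := iF1 Λ
    pslQuotientHom Λ.toSubgroup (LocObj.top Γ).toSubgroup 1 (hle1 Λ)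
  let A : _root_.Literature.AnabelianGeometry.AbsoluteAnabelian.LocObj Γ → C := fun Λ =>
    ⟨toRC.obj (@pslQuotient Λ.toSubgroup (iPD Λ) (iC Λ)), ⟨toRC.map (s Λ)⟩⟩
  -- the components at the `ℍ/Λ̄` come from `PGL(2, ℝ)` (sign-free RC fullness)
  have key : ∀ Λ : _root_.Literature.AnabelianGeometry.AbsoluteAnabelian.LocObj Γ, ∃ q : PGL(2, ℝ),
      (∀ τ : ℍ, (α.hom.app (A Λ)).hom.toFun (Quotient.mk (orbitRel Λ.toSubgroup ℍ) τ) =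
        Quotient.mk (orbitRel Λ.toSubgroup ℍ) (q • τ)) ∧
      ∀ x ∈ Λ.toSubgroup, q * toPGL x * q⁻¹ ∈ Λ.toSubgroup.map (toPGL (n := Fin 2) (R := ℝ)) := by
    intro Λ
    haveI := iPD Λ; haveI := iC Λ
    exact RC.exists_pgl_of_hom Λ.toSubgroup Λ.toSubgroup (α.hom.app (A Λ)).hom
  choose x hx hxconj using key
  -- naturality along the FINITE-index morphisms `[g] : Λ₁ → Λ₂`, read in `PGL(2, ℝ)`
  have hnat : ∀ {Λ₁ Λ₂ : _root_.Literature.AnabelianGeometry.AbsoluteAnabelian.LocObj Γ} (g : PSL2R)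
      (hg : ∀ y ∈ Λ₁.toSubgroup, g * y * g⁻¹ ∈ Λ₂.toSubgroup)
      [((conjSubgroup g Λ₁.toSubgroup).subgroupOf Λ₂.toSubgroup).FiniteIndex],
      toPGL g * x Λ₁ * (x Λ₂ * toPGL g)⁻¹ ∈ Λ₂.toSubgroup.map (toPGL (n := Fin 2) (R := ℝ)) := by
    intro Λ₁ Λ₂ g hg _
    haveI := iPD Λ₁; haveI := iC Λ₁; haveI := iPD Λ₂; haveI := iC Λ₂
    let φ : A Λ₁ ⟶ A Λ₂ :=
      ObjectProperty.homMk (toRC.map (pslQuotientHom Λ₁.toSubgroup Λ₂.toSubgroup g hg))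
    have hφ := α.hom.naturality φ
    refine RC.mul_inv_mem_of_forall_mk_smul_eq Λ₂.toSubgroup fun τ => ?_
    have e1 := congrArg (fun k : A Λ₁ ⟶ A Λ₂ => k.hom.toFun (Quotient.mk (orbitRel Λ₁.toSubgroup ℍ) τ)) hφ
    simp only [Functor.id_map, Functor.id_obj] at e1
    change (α.hom.app (A Λ₂)).hom.toFun
        ((toRC.map (pslQuotientHom Λ₁.toSubgroup Λ₂.toSubgroup g hg)).toFun
          (Quotient.mk (orbitRel Λ₁.toSubgroup ℍ) τ)) =
      (toRC.map (pslQuotientHom Λ₁.toSubgroup Λ₂.toSubgroup g hg)).toFun ((α.hom.app (A Λ₁)).hom.toFun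
        (Quotient.mk (orbitRel Λ₁.toSubgroup ℍ) τ)) at e1
    rw [hx Λ₁ τ, toRC_map_toFun, pslQuotientHom_toFun_mk, pslQuotientHom_toFun_mk, hx Λ₂] at e1
    rw [mul_smul, mul_smul, toPGL_smul, toPGL_smul]
    exact e1
  -- the component at `X` itself lies in the normaliser of `Γ̄'` (invertibility of `α_X`)
  have htop : x (LocObj.top Γ) ∈ Subgroup.normalizer (Γ' : Set PGL(2, ℝ)) := by
    obtain ⟨qt, hqt, hqtconj⟩ := RC.exists_pgl_of_hom Γ Γ (α.inv.app (A (LocObj.top Γ))).hom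
    have hcomp : ∀ τ : ℍ, Quotient.mk (orbitRel Γ ℍ) ((x (LocObj.top Γ) * qt) • τ) =
        Quotient.mk (orbitRel Γ ℍ) ((1 : PGL(2, ℝ)) • τ) := by
      intro τ
      have e0 := congrArg (fun k : A (LocObj.top Γ) ⟶ A (LocObj.top Γ) =>
        k.hom.toFun (Quotient.mk (orbitRel Γ ℍ) τ)) (α.inv_hom_id_app (A (LocObj.top Γ)))
      change (α.hom.app (A (LocObj.top Γ))).hom.toFun ((α.inv.app (A (LocObj.top Γ))).hom.toFun
        (Quotient.mk (orbitRel Γ ℍ) τ)) = Quotient.mk (orbitRel Γ ℍ) τ at e0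
      rw [hqt τ] at e0
      erw [hx (LocObj.top Γ)] at e0
      rw [mul_smul, one_smul]
      exact e0
    have hmem : (1 : PGL(2, ℝ)) * (x (LocObj.top Γ) * qt)⁻¹ ∈ Γ' :=
      RC.mul_inv_mem_of_forall_mk_smul_eq Γ hcomp
    rw [one_mul, Subgroup.inv_mem_iff] at hmem
    rw [Subgroup.mem_normalizer_iff]
    intro y
    constructor
    · intro hy
      obtain ⟨z, hz, rfl⟩ := Subgroup.mem_map.mp hy
      exact hxconj (LocObj.top Γ) z hz
    · intro hy
      have h3 : qt * ((x (LocObj.top Γ) * qt)⁻¹ * (x (LocObj.top Γ) * y * (x (LocObj.top Γ))⁻¹) *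
          (x (LocObj.top Γ) * qt)) * qt⁻¹ = y := by group
      rw [← h3]
      have h4 : (x (LocObj.top Γ) * qt)⁻¹ * (x (LocObj.top Γ) * y * (x (LocObj.top Γ))⁻¹) *
          (x (LocObj.top Γ) * qt) ∈ Γ' :=
        Γ'.mul_mem (Γ'.mul_mem (Γ'.inv_mem hmem) hy) hmem
      obtain ⟨z, hz, hz'⟩ := Subgroup.mem_map.mp h4
      rw [← hz']
      exact hqtconj z hz
  -- every component lies in `N(Γ̄')`: `x_Λ ∈ Γ̄' x_top`
  have hxN : ∀ Λ : _root_.Literature.AnabelianGeometry.AbsoluteAnabelian.LocObj Γ,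
      x Λ ∈ Subgroup.normalizer (Γ' : Set PGL(2, ℝ)) := by
    intro Λ
    haveI := iF1 Λ
    have h1 := hnat (Λ₁ := Λ) (Λ₂ := LocObj.top Γ) 1 (hle1 Λ)
    rw [map_one, one_mul, mul_one] at h1
    have h3 : x Λ = (x Λ * (x (LocObj.top Γ))⁻¹) * x (LocObj.top Γ) := by group
    rw [h3]
    exact (Subgroup.normalizer _).mul_mem (Subgroup.le_normalizer h1) htop
  -- the family on the objects of `Loc(PGL₂(ℝ), Γ̄')`
  let pre : _root_.Literature.AnabelianGeometry.AbsoluteAnabelian.LocObj Γ' →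
      _root_.Literature.AnabelianGeometry.AbsoluteAnabelian.LocObj Γ := fun Λ' =>
    { toSubgroup := Λ'.toSubgroup.comap (toPGL (n := Fin 2) (R := ℝ))
      le := fun y hy => by
        have : toPGL y ∈ Γ' := Λ'.le hy
        obtain ⟨z, hz, hzy⟩ := Subgroup.mem_map.mp this
        rwa [← toPGL_injective hzy]
      finiteIndex := by
        haveI := Λ'.finiteIndex
        let eΓ : Γ ≃* Γ' := Subgroup.equivMapOfInjective Γ _ toPGL_injective
        have hcomap : (Λ'.toSubgroup.comap (toPGL (n := Fin 2) (R := ℝ))).subgroupOf Γ =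
            (Λ'.toSubgroup.subgroupOf Γ').comap eΓ.toMonoidHom := by
          ext y
          rw [Subgroup.mem_subgroupOf, Subgroup.mem_comap, Subgroup.mem_comap, Subgroup.mem_subgroupOf,
            MulEquiv.coe_toMonoidHom, Subgroup.coe_equivMapOfInjective_apply]
        refine ⟨?_⟩
        rw [hcomap, Subgroup.index_comap_of_surjective _ eΓ.surjective]
        exact Subgroup.FiniteIndex.index_ne_zero }
  have hpre_le : ∀ {Λ' Λ'' : _root_.Literature.AnabelianGeometry.AbsoluteAnabelian.LocObj Γ'},
      Λ''.toSubgroup ≤ Λ'.toSubgroup → (pre Λ'').toSubgroup ≤ (pre Λ').toSubgroup :=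
    fun h => Subgroup.comap_mono h
  have hpre_map : ∀ Λ' : _root_.Literature.AnabelianGeometry.AbsoluteAnabelian.LocObj Γ',
      (pre Λ').toSubgroup.map (toPGL (n := Fin 2) (R := ℝ)) ≤ Λ'.toSubgroup :=
    fun Λ' => Subgroup.map_comap_le _ _
  -- hypothesis (Z) of `Loc(PGL₂(ℝ), Γ̄')`: abc-iut-L4-d1's free-or-surface normaliser shape + `C_{PGL₂(ℝ)}(Γ̄) = 1`
  have hΓ' : IsFreeOrSurface Γ' :=
    Literature.IUT.HodgeTheaters.IsFreeOrSurface.of_mulEquiv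
      (Subgroup.equivMapOfInjective Γ _ toPGL_injective).symm hΓ
  have hC : ∀ g ∈ Subgroup.normalizer (Γ' : Set PGL(2, ℝ)), (∀ γ ∈ Γ', g * γ = γ * g) → g = 1 := by
    intro g _ hg
    have hmem : g ∈ Subgroup.centralizer (Γ' : Set PGL(2, ℝ)) := by
      rw [Subgroup.mem_centralizer_iff]
      exact fun y hy => (hg y hy).symm
    rwa [pgl_centralizer_eq_bot Γ hab, Subgroup.mem_bot] at hmem
  have hZ : LocObj.CentralFamiliesTrivial Γ' :=
    LocObj.centralFamiliesTrivial_of_completion_normalizer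
      (Literature.GroupTheory.eq_one_of_forall_commute_etaFn_normalizer_of_isFreeOrSurface Γ' hΓ' hC)
  -- apply (Z) to the family `x ∘ pre` at the object `Γ̄'` itself
  have hconcl := hZ (fun Λ' => x (pre Λ')) (fun Λ' _ => hxN (pre Λ'))
    (fun Λ' Λ'' _ _ hle => by
      -- compatibility from naturality along the inclusion `[1] : pre Λ'' → pre Λ'`
      have hle' : ∀ y ∈ (pre Λ'').toSubgroup, (1 : PSL2R) * y * 1⁻¹ ∈ (pre Λ').toSubgroup :=
        fun y hy => by simpa using hpre_le hle hy
      haveI := LocObj.finiteIndex_conjSubgroup_subgroupOf_of_mem (pre Λ'') (pre Λ') Γ.one_mem hle'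
      have h1 := hnat (Λ₁ := pre Λ'') (Λ₂ := pre Λ') 1 hle'
      rw [map_one, one_mul, mul_one] at h1
      have h3 := hpre_map Λ' h1
      rw [← Subgroup.inv_mem_iff] at h3
      simpa using h3)
    (fun Λ' hΛ' γ hγ => by
      -- centrality from naturality along the deck transformation `[g] : pre Λ' → pre Λ'`, `γ = toPGL g`
      obtain ⟨g, hg, rfl⟩ := Subgroup.mem_map.mp hγ
      have hnormal : ∀ y ∈ (pre Λ').toSubgroup, g * y * g⁻¹ ∈ (pre Λ').toSubgroup := by
        intro y hy
        change toPGL (g * y * g⁻¹) ∈ Λ'.toSubgroup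
        rw [map_mul, map_mul, map_inv]
        exact hΛ' _ (Subgroup.mem_map_of_mem _ hg) _ hy
      haveI := LocObj.finiteIndex_conjSubgroup_subgroupOf_of_mem (pre Λ') (pre Λ') hg hnormal
      have h1 := hpre_map Λ' (hnat (Λ₁ := pre Λ') (Λ₂ := pre Λ') g hnormal)
      rw [← Subgroup.inv_mem_iff] at h1
      have e3 : (toPGL g * x (pre Λ') * (x (pre Λ') * toPGL g)⁻¹)⁻¹ =
          x (pre Λ') * toPGL g * (x (pre Λ'))⁻¹ * (toPGL g)⁻¹ := by group
      rwa [e3] at h1)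
    (LocObj.top Γ') (fun γ hγ y hy => Γ'.mul_mem (Γ'.mul_mem hγ hy) (Γ'.inv_mem hγ))
  have hpretop : pre (LocObj.top Γ') = LocObj.top Γ :=
    LocObj.ext_toSubgroup (Subgroup.comap_map_eq_self_of_injective toPGL_injective Γ)
  rw [hpretop] at hconcl
  change x (LocObj.top Γ) ∈ Γ' at hconcl
  obtain ⟨g₀, hg₀, hg₀x⟩ := Subgroup.mem_map.mp hconcl
  apply RC.hom_ext
  funext p
  induction p using Quotient.inductionOn with
  | h τ =>
    change (α.hom.app (A (LocObj.top Γ))).hom.toFun (Quotient.mk (orbitRel Γ ℍ) τ) =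
      Quotient.mk (orbitRel Γ ℍ) τ
    erw [hx (LocObj.top Γ) τ]
    rw [← hg₀x, toPGL_smul]
    exact Quotient.sound ⟨⟨g₀, hg₀⟩, rfl⟩

/-! ### The RC column without `hfin` -/

/-- ★★ **[AbsTopIII] Prop 4.2 (i) in print's RC-category, «objects of `RC` mapping to `ℍ/Γ̄`» ID-RIGID —
no `hfin`** (`Γ̄` free-or-surface, non-abelian, acting freely and properly discontinuously,
`[N_{PSL₂(ℝ)}(Γ̄) : Γ̄] < ∞`, PSL→PGL bridge inside). [cite: MochizukiAbsTopIII2015, Proposition 4.2 (i) proof p.106] -/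
theorem RC.isIdRigid_mapsTo_pslQuotient_of_isFreeOrSurface_hfinFree (hΓ : IsFreeOrSurface Γ)
    (hab : ∃ a b : Γ, a * b ≠ b * a)
    [(Γ.subgroupOf (Subgroup.normalizer (Γ : Set PSL2R))).FiniteIndex] :
    Literature.AnabelianGeometry.AbsoluteAnabelian.IsIdRigid
      (ObjectProperty.FullSubcategory fun Y : RC => Nonempty (Y ⟶ HolRS.toRC.obj (HolRS.pslQuotient Γ))) := by
  haveI := finiteIndex_map_toPGL_normalizer Γ
  exact isIdRigid_mapsTo_of_app_self_eq_id (toRC.obj (pslQuotient Γ))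
    (RC.app_self_eq_id_of_isFreeOrSurface_hfinFree Γ hΓ hab)
    (RC.isIdRigid_over_of_isSlimGroup (pslQuotient Γ) (Quotient.mk (orbitRel Γ ℍ) UpperHalfPlane.I)
      (isSlimGroup_profiniteCompletion_fundamentalGroup_pslQuotient_of_isFreeOrSurface Γ hΓ hab))

/-- ★★ **The geometric `EA` with PRINT-FAITHFUL (RC-holomorphic) morphisms over `X₀ = ℍ/Γ̄` is ID-RIGID — no
`hfin`** (`Γ̄` free-or-surface, non-abelian, acting freely and properly discontinuously; residual
hypothesis `hN` in the PSL currency ONLY). [cite: MochizukiAbsTopIII2015, Proposition 4.2 (i) proof p.106] -/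
theorem RC.isIdRigid_EA_mapsTo_pslQuotient_of_isFreeOrSurface_hfinFree (hΓ : IsFreeOrSurface Γ)
    (hab : ∃ a b : Γ, a * b ≠ b * a)
    (hN : ∀ Λ : _root_.Literature.AnabelianGeometry.AbsoluteAnabelian.LocObj Γ,
      (Λ.toSubgroup.subgroupOf (Subgroup.normalizer (Λ.toSubgroup : Set PSL2R))).FiniteIndex) :
    Literature.AnabelianGeometry.AbsoluteAnabelian.IsIdRigid
      (HolRS.geometricAutHolFieldFunctorRC fun Y : RC =>
        Nonempty (Y ⟶ HolRS.toRC.obj (HolRS.pslQuotient Γ))).EA := by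
  let Q : ObjectProperty RC := fun Y : RC => Nonempty (Y ⟶ toRC.obj (pslQuotient Γ))
  have hQ : ∀ {Y Z : RC}, (Y ⟶ Z) → Q Z → Q Y := fun f ⟨g⟩ => ⟨f ≫ g⟩
  change IsIdRigid Q.FullSubcategory
  refine isIdRigid_of_forall_isIdRigid_mapsTo fun X => ?_
  rw [isIdRigid_mapsTo_fullSubcategory_iff Q hQ X]
  obtain ⟨fX⟩ := X.property
  obtain ⟨eC, -, -⟩ := RC.exists_iso_ofCover (pslQuotient Γ) (Y := X.obj.of) fX
  obtain ⟨Λ, iPD, iC, ⟨eΛ⟩⟩ := exists_iso_pslQuotient_of_hom Γ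
    ((pslQuotient Γ).ofCover fX.isFiniteEtale.isCoveringMap fX.isFiniteEtale.finite_fibre)
    ((pslQuotient Γ).ofCoverHom fX.isFiniteEtale.isCoveringMap fX.isFiniteEtale.finite_fibre)
  haveI := hN Λ
  let i : toRC.obj (pslQuotient Λ.toSubgroup) ≅ X.obj := (toRC.mapIso eΛ).trans eC
  have hP : (fun Z : RC => Nonempty (Z ⟶ X.obj)) =
      fun Z : RC => Nonempty (Z ⟶ toRC.obj (pslQuotient Λ.toSubgroup)) := by
    funext Z
    exact propext ⟨fun ⟨f⟩ => ⟨f ≫ i.inv⟩, fun ⟨f⟩ => ⟨f ≫ i.hom⟩⟩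
  rw [hP]
  exact RC.isIdRigid_mapsTo_pslQuotient_of_isFreeOrSurface_hfinFree Λ.toSubgroup
    (HolRS.LocObj.isFreeOrSurface hΓ Λ) (HolRS.LocObj.exists_mul_ne_mul_of_isFreeOrSurface hΓ hab Λ)

/-- ★★ **[AbsTopIII] Cor 4.5 (i)–(v), PRINT-FAITHFUL morphisms, over `X₀ = ℍ/Γ̄` — no `hfin`** (`Γ̄`
free-or-surface, non-abelian; residual `hN` only). [cite: MochizukiAbsTopIII2015, Corollary 4.5 pp.107–109] -/
theorem RC.cor_4_5_geometric_mapsTo_pslQuotient_of_isFreeOrSurface_hfinFree (hΓ : IsFreeOrSurface Γ)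
    (hab : ∃ a b : Γ, a * b ≠ b * a)
    (hN : ∀ Λ : _root_.Literature.AnabelianGeometry.AbsoluteAnabelian.LocObj Γ,
      (Λ.toSubgroup.subgroupOf (Subgroup.normalizer (Λ.toSubgroup : Set PSL2R))).FiniteIndex) :
    Literature.AnabelianGeometry.AbsoluteAnabelian.AbsTopIII.Cor_4_5
      (Literature.AnabelianGeometry.AbsoluteAnabelian.archLogFrobeniusData
        (HolRS.geometricAutHolFieldFunctorRC fun Y : RC =>
          Nonempty (Y ⟶ HolRS.toRC.obj (HolRS.pslQuotient Γ))))
      (Literature.AnabelianGeometry.AbsoluteAnabelian.archTelecoreData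
        (HolRS.geometricAutHolFieldFunctorRC fun Y : RC =>
          Nonempty (Y ⟶ HolRS.toRC.obj (HolRS.pslQuotient Γ)))) :=
  cor_4_5_geometricRC _ ⟨toRC.obj (pslQuotient Γ), ⟨𝟙 _⟩⟩
    (RC.isIdRigid_EA_mapsTo_pslQuotient_of_isFreeOrSurface_hfinFree Γ hΓ hab hN)

/-- ★★ **PUNCTURED case, print-faithful morphisms, no `hfin`**: `Γ̄` free-or-surface, non-abelian, acting
freely and properly discontinuously, with (P)+(FC) ⇒ the geometric `EA` of the RC instance over `X₀ = ℍ/Γ̄`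
is ID-RIGID — residual = the cusp data ONLY. [cite: MochizukiAbsTopIII2015, Proposition 4.2 (i) proof p.106] -/
theorem RC.isIdRigid_EA_mapsTo_pslQuotient_of_cusps_hfinFree (hΓ : IsFreeOrSurface Γ)
    (hab : ∃ a b : Γ, a * b ≠ b * a)
    (hP : ∃ t : SL(2, ℝ), QuotientGroup.mk' (Subgroup.center SL(2, ℝ)) t ∈ Γ ∧
      (t : Matrix (Fin 2) (Fin 2) ℝ).IsParabolic)
    (hFC : ∃ F : Finset (Fin 2 → ℝ), ∀ t : SL(2, ℝ),
      QuotientGroup.mk' (Subgroup.center SL(2, ℝ)) t ∈ Γ → (t : Matrix (Fin 2) (Fin 2) ℝ).IsParabolic →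
      ∀ v : Fin 2 → ℝ, v ≠ 0 → (∃ c : ℝ, (t : Matrix (Fin 2) (Fin 2) ℝ) *ᵥ v = c • v) →
      ∃ g : SL(2, ℝ), QuotientGroup.mk' (Subgroup.center SL(2, ℝ)) g ∈ Γ ∧ ∃ w ∈ F, ∃ c : ℝ,
        (g : Matrix (Fin 2) (Fin 2) ℝ) *ᵥ v = c • w) :
    Literature.AnabelianGeometry.AbsoluteAnabelian.IsIdRigid
      (HolRS.geometricAutHolFieldFunctorRC fun Y : RC =>
        Nonempty (Y ⟶ HolRS.toRC.obj (HolRS.pslQuotient Γ))).EA :=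
  RC.isIdRigid_EA_mapsTo_pslQuotient_of_isFreeOrSurface_hfinFree Γ hΓ hab
    (LocObj.finiteIndex_subgroupOf_normalizer_of_cusps hΓ hab hP hFC)

/-- ★★ **Cor 4.5 (i)–(v), PUNCTURED case, print-faithful morphisms, no `hfin`** (residual = (P)+(FC) only).
[cite: MochizukiAbsTopIII2015, Corollary 4.5 pp.107–109] -/
theorem RC.cor_4_5_geometric_mapsTo_pslQuotient_of_cusps_hfinFree (hΓ : IsFreeOrSurface Γ)
    (hab : ∃ a b : Γ, a * b ≠ b * a)
    (hP : ∃ t : SL(2, ℝ), QuotientGroup.mk' (Subgroup.center SL(2, ℝ)) t ∈ Γ ∧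
      (t : Matrix (Fin 2) (Fin 2) ℝ).IsParabolic)
    (hFC : ∃ F : Finset (Fin 2 → ℝ), ∀ t : SL(2, ℝ),
      QuotientGroup.mk' (Subgroup.center SL(2, ℝ)) t ∈ Γ → (t : Matrix (Fin 2) (Fin 2) ℝ).IsParabolic →
      ∀ v : Fin 2 → ℝ, v ≠ 0 → (∃ c : ℝ, (t : Matrix (Fin 2) (Fin 2) ℝ) *ᵥ v = c • v) →
      ∃ g : SL(2, ℝ), QuotientGroup.mk' (Subgroup.center SL(2, ℝ)) g ∈ Γ ∧ ∃ w ∈ F, ∃ c : ℝ,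
        (g : Matrix (Fin 2) (Fin 2) ℝ) *ᵥ v = c • w) :
    Literature.AnabelianGeometry.AbsoluteAnabelian.AbsTopIII.Cor_4_5
      (Literature.AnabelianGeometry.AbsoluteAnabelian.archLogFrobeniusData
        (HolRS.geometricAutHolFieldFunctorRC fun Y : RC =>
          Nonempty (Y ⟶ HolRS.toRC.obj (HolRS.pslQuotient Γ))))
      (Literature.AnabelianGeometry.AbsoluteAnabelian.archTelecoreData
        (HolRS.geometricAutHolFieldFunctorRC fun Y : RC =>
          Nonempty (Y ⟶ HolRS.toRC.obj (HolRS.pslQuotient Γ)))) :=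
  RC.cor_4_5_geometric_mapsTo_pslQuotient_of_isFreeOrSurface_hfinFree Γ hΓ hab
    (LocObj.finiteIndex_subgroupOf_normalizer_of_cusps hΓ hab hP hFC)

end HolRS

end Literature.AnabelianGeometry.AbsoluteAnabelian

end
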